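import Mathlib.Data.Nat.Choose.Basic
import Mathlib.Tactic.Linarith
import Mathlib.Tactic.NormNum
import Mathlib.Tactic.Ring
import Mathlib.Tactic.IntervalCases
import Mathlib.Tactic.LinearCombination
import HarnessLib

/-!
# The (0,1) cell of the ι-window, XVIII: the product ground `B₁ × B₂`, V — QUESTION ISO in the minimal reading, `B₂` side:
# THEOREM ISO-LF (no isolated point of the double-sign jump locus among locally free WIT₁ factors) — algebraic skeleton;
# and the documented block on the five odd-torsion bullets of the cover (Castelnuovo table)

Family `hodge`, b2b cell `hweil` (helper of item stmt-HodgeConjecture-2524). Report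
`run/shared/lean/b2b/hodge-weil/b2b-hweil-pv1-g30/H2-ZERO-ONE-18.md` (prover 1 gen 30). Companion to
`WeilTypeLadderH2ProductGroundFour.lean` (gen 29: HOM-ONE, ISO-RED, POP, INF, KL; `pg4_*`). HONEST FRAMING: census results inside the ladder's
H2 test ((0,1) cell) on the SPECIAL fourfold `X₀ = B₁ × B₂`; by the cell's THEOREM U5 an object there would decide H2 positively, emptiness /
non-isolation of a family there is a census line and nothing more. No case of the Hodge conjecture is proved; nothing here is a rung; no
statement of [Markman 2025] / [Perry 2026] / [EdGFS 2025] is used. The kernel content is the elementary arithmetic and combinatorics of the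
report (bounded diophantine classifications, parity facts, degree and Euler-characteristic bookkeeping, one commutative-ring identity); the
geometry (Mukai's transform dictionary, Picard groups of nodal curves, Kummer tropes, Narasimhan–Ramanan, Thom–Porteous) is quoted print and
the cell's certified items, and every head below is a SHADOW of a named step of the report, not a formalisation of it.

## THEOREM ISO-LF (report §3)

For a rigid `R₂ = 𝓘_Z(−Θ_κ)` on a very general ppas `B`, the double-sign jump locus `𝓙(R₂)` inside the 6-dimensional moduli of balanced simple
ι-invariant sheaves of class `(2,0,−2)` has NO isolated point among locally free `𝒩` whose theta-twist is WIT₁. Skeleton: `pg5_h1_member`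
(LEMMA G3: `h¹(𝒪_D) = 2 + 4 − 1 = 5` with `3` invariants — the twist group is 3-dimensional); `pg5_riemann_hurwitz_rational_quotient`,
`pg5_contact_parity`, `pg5_rigid_support_types` (LEMMA RS: the supports on which the twist action can fix a sheaf satisfy a bounded diophantine
system whose solutions are exactly four types; LEMMA TROPE kills two of them); `pg5_trope_incidence` (the `(16,6)` incidence count behind 'two
nodes lie on two tropes'); `pg5_smoothing_chi` (LEMMA SM); `pg5_two_c_chi`, `pg5_two_c_ranks`, `pg5_picard_chern` (LEMMA NL on the double theta
curves: `2d + ℓ = 2`, the three Porteous cases, and `c(−Rp_*) = e^{θ}` as the inverse of `e^{−θ}` in the truncated ring); `pg5_s1_ext_dim`,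
`pg5_node_hom_count`, `pg5_pop_a_prime_degree`, `pg5_pop_a_prime_genus` (the residual bookkeeping and REMARK POP (a′)).

## The five bullets of [14] 6.1 (report §1)

`pg5_filling_span`, `pg5_castelnuovo_table`: a `2θ̃`-filling reduced irreducible curve of class `z·θ̃³/6` on the cover, birationally embedded by
`|L̃²β|_D| ≅ ℙ²⁹`, has `z ≥ 2` (span) and, by Castelnuovo's bound `π(16z, 29)` against OT-C's `h¹ ≥ 8z + 56`, `z ≥ 6` (REMARK OT-C′ — a remark
inside a documented block, not a closure). `pg5_d_zero_local_index`: the local-index identity of bullet `d = 0`.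
-/

-- mandated namespace `Summit.HodgeConjecture.HodgeConjecture.…` (Problem = Summit) trips `linter.dupNamespace`; the lakefile disables it
-- tree-wide (weak option), restated here so stand-alone elaboration is warning-free too.
set_option linter.dupNamespace false

namespace Summit.HodgeConjecture.HodgeConjecture.WeilTypeLadder

section ProductGroundFive

/-! ### LEMMA G3 and LEMMA RS — the twist group and the rigid supports (report §3.1, §3.4) -/

/-- **LEMMA G3 bookkeeping (report §3.1).** From `0 → H¹(𝒪_B) → H¹(𝒪_D) → ker(H²(𝒪_B(−D)) → H²(𝒪_B)) → 0` with
`h¹(𝒪_B) = 2` (ι-anti-invariant), `h²(𝒪_B(−D)) = h⁰(𝒪_B(2Θ₀)) = 4` and `h²(𝒪_B) = 1` (both ι-invariant): `h¹(𝒪_D) = 5` for every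
member `D ∈ |2Θ₀|`, with invariant part of dimension `3` and anti-invariant part of dimension `2`. [shadow of the dimension count] -/
theorem pg5_h1_member (h1B h0L h2B inv anti : ℕ) (hB : h1B = 2) (hL : h0L = 4) (h2 : h2B = 1)
    (hinv : inv = h0L - h2B) (hanti : anti = h1B) :
    anti + inv = 5 ∧ inv = 3 ∧ anti = 2 := by
  subst hB; subst hL; subst h2; subst hinv; subst hanti; decide

/-- **Riemann–Hurwitz for an involution with rational quotient (report §3.4 (ii)).** A smooth curve of genus `g` with an involution
having `r` fixed points and quotient of genus `0` satisfies `2g − 2 = 2·(2·0 − 2) + r`, i.e. `r = 2g + 2`. [shadow] -/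
theorem pg5_riemann_hurwitz_rational_quotient (g r : ℤ) :
    2 * g - 2 = 2 * (2 * 0 - 2) + r ↔ r = 2 * g + 2 := by
  constructor <;> intro h <;> linarith

/-- **LEMMA PAR, contact-order parity (report §3.4 (iii)).** A double point `A_{2n−1}` (two smooth branches with contact order `n ≥ 1`)
at a half-period of a symmetric member of `|2Θ₀|` has ι-STABLE branches iff `n` is odd (`A₁, A₅, A₉, …`, index `≡ 1 mod 4`) and EXCHANGED
branches iff `n` is even (`A₃, A₇, …`, index `≡ 3 mod 4`). [shadow: the residue arithmetic] -/
theorem pg5_contact_parity (n : ℕ) (hn : 1 ≤ n) :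
    ((2 * n - 1) % 4 = 1 ↔ n % 2 = 1) ∧ ((2 * n - 1) % 4 = 3 ↔ n % 2 = 0) := by
  omega

/-- **LEMMA RS (iv), the diophantine classification of rigid supports (report §3.4 (iv)).** For an irreducible member of `|2Θ₀|`
(`p_a = 5`) let `a₁, a₅, a₉` count the half-period points of types `A₁, A₅, A₉` (ι-stable branches; `δ = 1, 3, 5`; two fixed points of ι on
the normalisation each), `b₃, b₇` those of types `A₃, A₇` (exchanged branches; `δ = 2, 4`; no fixed points), and `c ≥ 0` the total `δ` of the
ι-conjugate pairs of singular points off the half-periods (each pair contributes an even amount `2·δ_x`, recorded as `2c`). 'The twist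
group fixes the sheaf' forces the normalisation (genus `5 − δ ≥ 1`) to have RATIONAL ι-quotient, i.e. `#Fix = 2(a₁+a₅+a₉) = 2(5 − δ) + 2`,
written `a₁ + a₅ + a₉ + δ = 6`. The solutions with `δ ≤ 4` are EXACTLY the four types I (`a₁ = 3`: the trinodal sections `D_{Z'}`),
IIa (`a₁ = 2, b₃ = 1`), IIb (`a₁ = 2, c = 1`), IIc (`a₁ = 1, a₅ = 1`); LEMMA TROPE then removes IIa and IIc. [shadow: complete case split] -/
theorem pg5_rigid_support_types (a1 a5 a9 b3 b7 c δ : ℕ)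
    (hδ : δ = a1 + 3 * a5 + 5 * a9 + 2 * b3 + 4 * b7 + 2 * c) (hle : δ ≤ 4) :
    a1 + a5 + a9 + δ = 6 ↔
      (a1 = 3 ∧ a5 = 0 ∧ a9 = 0 ∧ b3 = 0 ∧ b7 = 0 ∧ c = 0) ∨
      (a1 = 2 ∧ a5 = 0 ∧ a9 = 0 ∧ b3 = 1 ∧ b7 = 0 ∧ c = 0) ∨
      (a1 = 2 ∧ a5 = 0 ∧ a9 = 0 ∧ b3 = 0 ∧ b7 = 0 ∧ c = 1) ∨
      (a1 = 1 ∧ a5 = 1 ∧ a9 = 0 ∧ b3 = 0 ∧ b7 = 0 ∧ c = 0) := by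
  omega

/-- **The genus of the normalisation in the two surviving types (report §3.4 (vi)).** Type I: `δ = 3`, genus `2`, six fixed points
(the Weierstrass points); type IIb: `δ = 4`, genus `1`, four fixed points (ι = −1 on an elliptic curve). In both, the number of
half-period NODES is at least `2`, so one of them differs from the prescribed half-period `y`. [shadow] -/
theorem pg5_surviving_types_have_two_nodes :
    (5 - 3 = 2 ∧ 2 * 3 = 2 * 2 + 2 ∧ (2 : ℕ) ≤ 3) ∧ (5 - 4 = 1 ∧ 2 * 2 = 2 * 1 + 2 ∧ (2 : ℕ) ≤ 2) := by
  decide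

/-- **The (16,6) incidence count behind LEMMA TROPE (report §3.4 (v)).** Sixteen tropes with six nodes each carry `16·C(6,2) = 240`
incidences (trope, pair of nodes on it); with `C(16,2) = 120` pairs of nodes and every pair on the SAME number `t` of tropes, `t = 2`.
[shadow of the design count; the design property itself is classical Kummer geometry] -/
theorem pg5_trope_incidence : 16 * Nat.choose 6 2 = Nat.choose 16 2 * 2 ∧ Nat.choose 16 2 = 120 := by
  decide

/-- **Tangent planes through a line (report §3.4 (v)).** Projecting from the vertex, a rank-3 quadric cone becomes a smooth conic `c`
(degree `2` = class `2`); a line through the vertex becomes a point `ℓ`, and the planes through the line tangent to the cone become the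
tangents to `c` through `ℓ`: `2` if `ℓ ∉ c`, `1` if `ℓ ∈ c`. Two DISTINCT tangent planes through the line therefore force `ℓ ∉ c` and
exhaust the tangents. [shadow: `2 ≠ 1`, class of a conic] -/
theorem pg5_tangents_from_a_point : (2 : ℕ) * (2 - 1) = 2 ∧ (2 : ℕ) ≠ 1 := by decide

/-! ### LEMMA SM and the double theta curves (report §3.5, §3.6) -/

/-- **LEMMA SM, Euler characteristics of the smoothing family (report §3.5).** `𝒢 = ν_*N`, `N'' = N(p)` has `χ(N'') = χ(N) + 1 =
χ(𝒢) + 1`, and every member `F_c = ker(ν_*N'' → k_w)` of the family has `χ(F_c) = χ(N'') − 1 = χ(𝒢) = −2`: the family is flat over `𝔸¹`.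
[shadow] -/
theorem pg5_smoothing_chi (χG χN χN'' χF : ℤ) (h0 : χG = -2) (h1 : χN = χG) (h2 : χN'' = χN + 1) (h3 : χF = χN'' - 1) :
    χF = χG ∧ χF = -2 := by
  subst h0; subst h1; subst h2; subst h3; norm_num

/-- **LEMMA NL, the Euler characteristic on `2C` (report §3.6).** For a generically invertible pure sheaf `𝒢` on `2C` (`C = Θ_κ''` of
genus `2`) with `K = 𝓘_C 𝒢 ≅ Q' ⊗ K_C⁻¹` of degree `d − 2` and `𝒢|_C` = (line bundle of degree `d`) + (torsion of length `ℓ`):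
`χ(𝒢) = (d − 2 + 1 − 2) + (d + 1 − 2 + ℓ) = 2d − 4 + ℓ`, so `χ = −2 ⟺ 2d + ℓ = 2`; then `ℓ` is even, `ℓ = 0 ⟺ d = 1` (line bundles on
`2C`) and `ℓ ≥ 1 ⟺ d ≤ 0`. [shadow] -/
theorem pg5_two_c_chi (d ℓ : ℤ) (hℓ : 0 ≤ ℓ) :
    ((d - 2 + 1 - 2) + (d + 1 - 2 + ℓ) = -2 ↔ 2 * d + ℓ = 2) ∧
    (2 * d + ℓ = 2 → ℓ % 2 = 0 ∧ (ℓ = 0 ↔ d = 1) ∧ (1 ≤ ℓ ↔ d ≤ 0)) := by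
  omega

/-- **LEMMA NL, the three Porteous cases (report §3.6 (ii)).** With `ℓ = 2 − 2d` sections of the torsion and `h¹(K ⊗ ξ) = 3 − d`:
for `d ≤ −2` the source rank exceeds the target rank (a kernel for every `ξ`); for `d = −1` both ranks are `4` (a determinant, class `θ`);
for `d = 0` the ranks are `2 → 3`, the expected codimension of `{rank ≤ 1}` is `(3−1)(2−1) = 2 = dim J(C)` and the Thom–Porteous class is
`c₂ = θ²/2` of degree `2/2 = 1 ≠ 0`. [shadow: the rank arithmetic] -/
theorem pg5_two_c_ranks (d : ℤ) :
    (d ≤ -2 → 3 - d < 2 - 2 * d) ∧ (d = -1 → 2 - 2 * d = 4 ∧ 3 - d = 4) ∧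
    (d = 0 → 2 - 2 * d = 2 ∧ 3 - d = 3 ∧ (3 - 1) * (2 - 1) = (2 : ℤ) ∧ (2 : ℤ) / 2 = 1 ∧ (1 : ℤ) ≠ 0) := by
  refine ⟨fun h => by omega, fun h => by omega, fun h => ⟨by omega, by omega, by norm_num, by norm_num, by norm_num⟩⟩

/-- **`c(−Rp_*(M ⊠ 𝓟)) = e^{θ}` (report §3.6 (ii)).** On the Jacobian surface of a genus-2 curve GRR gives `ch(Rp_*(M ⊠ 𝓟)) = (m − 1) − θ`,
i.e. total Chern class `1 − θ + h` with `h = θ²/2` (and `h·h = 0`: classes of degree `> 4` vanish on a surface); the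
class of `R¹p_*` (with `R⁰ = 0`) is its inverse, and `(1 − θ + h)(1 + θ + h) = 1` in the truncated ring — so `c₁(R¹p_*) = θ`,
`c₂(R¹p_*) = θ²/2`. [shadow: the ring identity, with `2h = θ²` and `h² = 0` as hypotheses] -/
theorem pg5_picard_chern {R : Type*} [CommRing R] (θ h : R) (h2 : 2 * h = θ * θ) (h4 : h * h = 0) :
    (1 - θ + h) * (1 + θ + h) = 1 := by
  have e : (1 - θ + h) * (1 + θ + h) = 1 + (2 * h - θ * θ) + h * h := by ring
  rw [e, h2, h4]; ring

/-- **LEMMA VB, degrees on the theta curve (report §3.6 (i)).** A rank-2 bundle `E` on the genus-2 curve `C` with `χ(i_*E) = −2` has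
degree `0` (`−2 = deg + 2(1 − 2)`); `SU_C(2, δ)` for `δ` of even degree is `ℙ³` (dimension `3`), the Prym of an étale double cover
of `C` has dimension `3 − 2 = 1`, and the six Weierstrass points carry the balanced pattern only if the number of `−1`-eigenvalues
of `det E = δ` (one per point) is even: `6 ≡ 0 (mod 2)`. [shadow] -/
theorem pg5_vb_degrees (deg : ℤ) :
    (-2 = deg + 2 * (1 - 2) ↔ deg = 0) ∧ (3 : ℤ) - 2 = 1 ∧ (6 : ℤ) % 2 = 0 := by
  refine ⟨by omega, by norm_num, by norm_num⟩

/-! ### The residual strata and REMARK POP (a′) (report §3.8, §3.9) -/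

/-- **(S1) bookkeeping (report §3.8 (r3)).** `dim Ext¹(P, P𝓘_W) = dim H¹(𝓘_W) = h⁰(𝒪_W) + h¹(𝒪_B) − rank(H⁰(𝒪_B) → H⁰(𝒪_W)) =
2 + 2 − 1 = 3`, and `hom(R₂, 𝒩) ≤ hom(R₂, P𝓘_W) + hom(R₂, P) ≤ 1 + 1 = 2`. [shadow] -/
theorem pg5_s1_ext_dim : (2 : ℕ) + 2 - 1 = 3 ∧ (1 : ℕ) + 1 = 2 := by decide

/-- **REMARK POP (a′), the node count (report §3.9).** On the `B₁` side `hom(R₁, i_*M) = 6 + k_free + 2·k_nonfree` (a node of `D` at a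
point of `Z₁` where `M` is free adds `1`, where `M` is not free adds `2`, when `h¹ = 0`); the corner total `8` is reached exactly by
`(k_free, k_nonfree) ∈ {(2,0), (0,1)}` — POP (a) of [17] and the new stratum POP (a′). [shadow: complete case split] -/
theorem pg5_node_hom_count (kf knf : ℕ) :
    6 + kf + 2 * knf = 8 ↔ (kf = 2 ∧ knf = 0) ∨ (kf = 0 ∧ knf = 1) := by
  omega

/-- **REMARK POP (a′), degrees and the eigen-splitting (report §3.9).** `M = ν_*N` with `χ(M) = 2` on the normalisation of genus `4`
gives `deg N = 5`; `N(p + p' + Θ_κ)` has degree `5 + 2 + 4 = 11 > 2·4 − 2`, so `h¹ = 0` and `hom = 11 + 1 − 4 = 8`; holomorphic Lefschetz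
with fixed points `p, p'` only and fibre signs `−e·ε, −e·(−ε)` gives trace `0`, i.e. `hom^± = (4,4)`. [shadow] -/
theorem pg5_pop_a_prime_degree (degN e ε : ℤ) (hχ : degN + 1 - 4 = 2) :
    degN = 5 ∧ degN + 2 + 4 = 11 ∧ (11 : ℤ) > 2 * 4 - 2 ∧ (11 : ℤ) + 1 - 4 = 8 ∧ (-e * ε + -e * -ε = 0) := by
  refine ⟨by omega, by omega, by norm_num, by norm_num, by ring⟩

/-- **REMARK POP (a′), Riemann–Hurwitz and the dimension of the stratum (report §3.9).** The normalisation (genus `4`) has two ι-fixed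
points, so its quotient `Γ` has genus `2` (`2·4 − 2 = 2(2·2 − 2) + 2`); the stratum has dimension `dim|2Θ₀ − z₁| + dim Pic²(Γ) = 2 + 2 = 4`
(no gluing parameter). [shadow] -/
theorem pg5_pop_a_prime_genus (g' : ℤ) : (2 * 4 - 2 = 2 * (2 * g' - 2) + 2 ↔ g' = 2) ∧ (2 : ℤ) + 2 = 4 := by
  refine ⟨by omega, by norm_num⟩

/-! ### The five bullets of [14] 6.1 — REMARK OT-C′ and bullet `d = 0` (report §1) -/

/-- **Span count for a filling curve (report §1.1 (b)(i)).** A `2θ̃`-filling curve of class `z·θ̃³/6` (`2θ̃`-degree `16z`) is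
non-degenerate in `ℙ²⁹ = ℙ(H⁰(L̃²β|_D)^*)` (`h⁰ = 2·2⁴ − 2 = 30`), so `16z ≥ 29`, i.e. `z ≥ 2`. [shadow] -/
theorem pg5_filling_span (z : ℕ) (h : 29 ≤ 16 * z) : 2 ≤ z ∧ 2 * 2 ^ 4 - 2 = 30 := by
  refine ⟨by omega, by decide⟩

/-- **REMARK OT-C′, the Castelnuovo table (report §1.1 (b)(ii)).** Castelnuovo's bound for a non-degenerate integral curve of degree
`δ` in `ℙ^r`: `π(δ,r) = m(m−1)(r−1)/2 + mε` where `δ − 1 = m(r−1) + ε`, `0 ≤ ε < r − 1`. With `r = 29`, `δ = 16z`: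
`π(32,29) = 3 < 72`, `π(48,29) = 19 < 80`, `π(64,29) = 42 < 88`, `π(80,29) = 74 < 96`, `π(96,29) = 117 ≥ 104` — against OT-C's demand
`h¹ ≥ 8z + 56` (k = 1, r₃ = 0): `z ∈ {2,3,4,5}` excluded, `z = 6` not. [shadow: the five evaluations with their Euclidean divisions] -/
theorem pg5_castelnuovo_table :
    (32 - 1 = 1 * 28 + 3 ∧ 3 < 28 ∧ 1 * (1 - 1) / 2 * 28 + 1 * 3 = 3 ∧ 3 < 8 * 2 + 56) ∧
    (48 - 1 = 1 * 28 + 19 ∧ 19 < 28 ∧ 1 * (1 - 1) / 2 * 28 + 1 * 19 = 19 ∧ 19 < 8 * 3 + 56) ∧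
    (64 - 1 = 2 * 28 + 7 ∧ 7 < 28 ∧ 2 * (2 - 1) / 2 * 28 + 2 * 7 = 42 ∧ 42 < 8 * 4 + 56) ∧
    (80 - 1 = 2 * 28 + 23 ∧ 23 < 28 ∧ 2 * (2 - 1) / 2 * 28 + 2 * 23 = 74 ∧ 74 < 8 * 5 + 56) ∧
    (96 - 1 = 3 * 28 + 11 ∧ 11 < 28 ∧ 3 * (3 - 1) / 2 * 28 + 3 * 11 = 117 ∧ ¬ (117 < 8 * 6 + 56)) := by
  decide

/-- **Bullet `d = 0`, the local index identity (report §1.5 (b)(ii)).** At a fixed point where `W` is smooth of codimension `c`,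
`t_x(𝒪_W) = 2^c` (Koszul), `t_x(Ḡ) = e·(1 − 2^c)` and `t_x(G̃) = e` ([14] 4.2 with `d = 0`), so `t_x(T) = t_x(G̃) − t_x(Ḡ) = e·2^c`.
[shadow: the ring identity] -/
theorem pg5_d_zero_local_index (e : ℤ) (c : ℕ) : e - e * (1 - 2 ^ c) = e * 2 ^ c := by
  ring

end ProductGroundFive

/-! ## ADDENDUM 1 (report [18] §11): THEOREM R2 — the non-WIT₁ locally free stratum (r2) via Prym torsors

For a locally free μ-stable `𝒩` of class `(2,0,−2)` with `h⁰(𝒩(Θ_z)) ≥ 1` for every `z`, each `𝒪(−Θ_z)` is a SATURATED sub-line-bundle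
(`pg5_r2_saturation`), two of them present `𝒩^∨ = ker(𝒪(Θ_{z₁}) ⊕ 𝒪(Θ_{z₂}) → λ)` with `λ` of degree `8` on the degeneracy curve `D`
(`pg5_r2_degrees`), and non-WIT forces the `P`-torsor `T_λ = {μ_w}` (`deg μ_w = 4`) into the theta divisor `W₄(D)`; the `P`-torsors inside
`W₄(D)` are only the odd one (`pg5_r2_torsor_count`: for `Nm = M ≠ K_{D̄}`, `h⁰(M) = 2` and the effective line bundles in `Nm⁻¹(M)` form a
family of dimension `1 < 2`; `pg5_r2_odd_parity`: the torsor `{𝒪_D(Θ_c)}` has `h⁰ ≡ 1`), and the odd torsor makes `λ ≅ 𝒪_D(Θ_a + Θ_b)`,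
which destabilises `𝒩`. Shadows only; the geometry (Mumford's parity and `W ∩ P⁺ = 2Ξ`) is quoted print.
-/

section ProductGroundFiveR2

/-- **Saturation (report §11.1, Step 1).** The saturation `M ≡ mθ` of `𝒪(−Θ_z) ↪ 𝒩` has `μ(M) = 2m < 0 = μ(𝒩)` by μ-stability, so
`m ≤ −1`, and receives a non-zero map from `𝒪(−Θ_z)`, so `m + 1 ≥ 0`; hence `m = −1` and `M = 𝒪(−Θ_z)` (a degree-0 line bundle with a
section is trivial). [shadow] -/
theorem pg5_r2_saturation (m : ℤ) (hstab : 2 * m < 0) (hmap : 0 ≤ m + 1) : m = -1 := by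
  omega

/-- **Degrees in the elementary-transformation presentation (report §11.1, Steps 2–5).** `χ(T) = χ(𝒩) − 2χ(𝒪(−Θ)) = −2 − 2 = −4`;
dually `χ(λ) = 2χ(𝒪(Θ)) − χ(𝒩^∨) = 2 + 2 = 4`, so on the genus-5 curve `D` the line bundle `λ` has degree `4 + 4 = 8`; the defining
sections `φ_i ∈ H⁰(λ(−Θ_{z_i}))` have degree `8 − 4 = 4` (`Θ·D = θ·2θ = 4`); `μ_w = 𝒪_D(Θ_{z₁}+Θ_{z₂}+Θ_w) ⊗ λ⁻¹` has degree
`4 + 4 + 4 − 8 = 4 = g(D) − 1`; and `h⁰(D, λ(Θ_w)) = 12 + 1 − 5 = 8 = 4 + 4` (the kernel condition is a square system). [shadow] -/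
theorem pg5_r2_degrees :
    (-2 : ℤ) - 2 * 1 = -4 ∧ (2 : ℤ) * 1 - (-2) = 4 ∧ (4 : ℤ) + (5 - 1) = 8 ∧ (8 : ℤ) - 4 = 4 ∧
    (4 : ℤ) + 4 + 4 - 8 = 4 ∧ (4 : ℤ) = 5 - 1 ∧ (12 : ℤ) + 1 - 5 = 8 ∧ (8 : ℤ) = 4 + 4 := by
  norm_num

/-- **LEMMA PT, the dimension count (report §11.2).** On the smooth plane quartic `D̄ = D/ι` (genus `3`) a line bundle `M ≠ K_{D̄}` of
degree `4 = 2·3 − 2` has `h⁰(M) = 4 + 1 − 3 + h⁰(K_{D̄} ⊗ M⁻¹) = 2` (`deg(K ⊗ M⁻¹) = 0`, non-trivial); the effective line bundles `L`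
with `Nm L = M` satisfy `div s + ι·div s = π^*G`, `G ∈ |M| ≅ ℙ¹`, with finitely many choices of `div s` per `G`: a family of dimension
`(2 − 1) + 0 = 1`, which cannot contain a torsor under the 2-dimensional Prym. For `M = K_{D̄}`: `h⁰ = 3`, dimension `2` — the odd torsor
`P⁻`. [shadow: the Riemann–Roch and dimension arithmetic] -/
theorem pg5_r2_torsor_count (h0KM : ℤ) (hKM : h0KM = 0) :
    4 + 1 - 3 + h0KM = 2 ∧ (2 : ℤ) - 1 + 0 = 1 ∧ (1 : ℤ) < 2 ∧ (3 : ℤ) - 1 + 0 = 2 := by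
  subst hKM; norm_num

/-- **LEMMA F = P⁻ (report §11.3).** For every theta translate, `h⁰(𝒪_D(Θ_c)) = h⁰(𝒪_B(Θ_c)) + h¹(𝒪_B(Θ_c − D)) = 1 + 0 = 1` (the
kernel `H⁰(𝒪_B(Θ_c − D))` vanishes and `𝒪_B(Θ_c − D) ≡ −θ` has no `H¹`), an ODD number, and `Nm 𝒪_D(Θ_c ∩ D) = 𝒪_{D̄}(1) = K_{D̄}`
(the `4 = Θ·D` points map to a line section of the plane quartic): so the torsor `{𝒪_D(Θ_c)|_D}` is Mumford's odd component `P⁻`.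
[shadow: `1 + 0 = 1` is odd; `Θ·D = 4 = deg K_{D̄}`] -/
theorem pg5_r2_odd_parity : (1 : ℕ) + 0 = 1 ∧ (1 : ℕ) % 2 = 1 ∧ (1 : ℤ) * 2 * 2 = 4 ∧ (2 : ℤ) * 3 - 2 = 4 := by
  decide

/-- **THEOREM R2, the destabilising sub-line-bundle (report §11.4).** If `λ ≅ 𝒪_D(Θ_a + Θ_b)|_D` then `𝒪_D(G₂) = λ(−Θ_{z₂}) ≅
𝒪_D(Θ_{a+b−z₂})` and `𝒪_D(G₁) ≅ 𝒪_D(Θ_{a+b−z₁})`, both of degree `4` with `h⁰ = 1`, so `G_i` ARE theta sections; the two resulting maps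
`ξ → 𝒪(Θ_{z_i})` come from the SAME `ξ ∈ Pic⁰(B)`: `z₁ − (a + b − z₂) = z₂ − (a + b − z₁)`; and `ξ ↪ 𝒩^∨` has slope `0 = μ(𝒩^∨)` —
not μ-stable. [shadow: the point identity in `B̂` and the slope equality] -/
theorem pg5_r2_destabilise (a b z₁ z₂ : ℤ) :
    z₁ - (a + b - z₂) = z₂ - (a + b - z₁) ∧ (8 : ℤ) - 4 = 4 ∧ (0 : ℤ) = 0 * 2 := by
  refine ⟨by ring, by norm_num, by norm_num⟩

end ProductGroundFiveR2

/-! ## ADDENDUM 3 (report [18] §13): THEOREM V — universally Kummer-coplanar four-point schemes lie on a theta translate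

On the Fourier side `A := R⁰Φ(𝓘_V(2Θ₀)) ⊂ W₂ := Φ(𝒪(2Θ₀))` (rank `4`, μ-STABLE of slope `−1`, `ch = (4, −2θ̂, 1)`, `c₂ = 3`:
`pg5_v_chern`) with `W₂/A ↪ Φ(𝒪_V)` (semistable of slope `0`); writing `c₁(A) = aθ̂`, `c₁(W₂/A) = bθ̂`, `r = rk A`, stability gives
`2a < −r`, `−(4 − r) < 2b ≤ 0`, `a + b = −2`, whose solutions are tabulated by `pg5_v_slope_table`; the cases `b = 0` die on a base point,
`r = 2, 3` need `#Supp V ≤ 2` resp. `= 1` (`pg5_v_support_count`), and the surviving case `r = 1, (a,b) = (−1,−1)` is `A = Φ(𝒪(Θ_c))`,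
i.e. `V ⊂ Θ_e`. Shadows only.
-/

section ProductGroundFiveV

/-- **`ch(W₂)` (report §13.1).** `W₂ = Φ(𝒪(2Θ₀))` has `ch = Φ_H(1, 2θ, 4) = (4, −2θ̂, 1)`: rank `h⁰(𝒪(2Θ₀)) = 4`, `c₁ = −2θ̂`
(`c₁² = 8`), `χ = 1`, hence `c₂ = 3` from `χ = (c₁² − 2c₂)/2`; slope `μ = 2·(−2)/4 = −1`. [shadow] -/
theorem pg5_v_chern (c₂ : ℤ) : ((8 - 2 * c₂ = 2 * 1) ↔ c₂ = 3) ∧ (2 * (-2) : ℤ) = 4 * (-1) := by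
  refine ⟨by omega, by norm_num⟩

/-- **The slope table (report §13.2).** `r = rk A ∈ {1,2,3}`, `c₁(A) = aθ̂`, `c₁(W₂/A) = bθ̂`, `a + b = −2`; μ-stability of `W₂`
gives `μ(A) = 2a/r < −1`; `W₂/A ⊂ Φ(𝒪_V)` (semistable, slope `0`) gives `b ≤ 0` (the quotient bound `2b/(4−r) > −1` is then
automatic). The solutions are EXACTLY: `r = 1` with `(a,b) ∈ {(−1,−1), (−2,0)}`, `r = 2` with `(a,b) = (−2,0)`, `r = 3` with
`(a,b) = (−2,0)`. [shadow: complete case split] -/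
theorem pg5_v_slope_table (r a b : ℤ) (hr : 1 ≤ r ∧ r ≤ 3) (hab : a + b = -2) (hA : 2 * a < -r) (hb : b ≤ 0) :
    (r = 1 ∧ ((a = -1 ∧ b = -1) ∨ (a = -2 ∧ b = 0))) ∨ (r = 2 ∧ a = -2 ∧ b = 0) ∨ (r = 3 ∧ a = -2 ∧ b = 0) := by
  omega

/-- **Support counts (report §13.3).** A semistable rank-2 sheaf of slope `0` maps non-trivially onto at most `2` pairwise distinct
degree-0 line bundles (its Jordan–Hölder factors), so `r = 2` forces `#Supp V ≤ 2 < 4` (V non-reduced); `r = 3` forces all Kummer images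
of `V + a` to coincide, i.e. `#Supp V = 1`, and a length-4 scheme does not fit in the length-2 fibre `κ⁻¹(point)` (`4 > 2`); in the
surviving case `r = 1` the generic `h⁰(𝓘_{V+a}(2Θ₀))` is `4 − 3 = 1`. [shadow] -/
theorem pg5_v_support_count : (2 : ℕ) < 4 ∧ (4 : ℕ) > 2 ∧ (4 : ℕ) - 3 = 1 ∧ (4 : ℕ) - 2 = 2 := by
  decide

end ProductGroundFiveV

/-! ## ADDENDUM 4 (report [18] §14): LEMMA W2, LEMMA LINES, THEOREM V⁺ and THEOREM WIT — the stratum (r2) is EMPTY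

`pg5_no_line_on_kummer`: a line on the Kummer quartic would pull back to a curve `Γ` with `2θ·Γ ≤ 2`, but every curve on a ppas with
`NS = ℤθ` has class `mθ`, `m ≥ 1`, and `2θ·mθ = 4m ≥ 4`. `pg5_tangency_count`: a line tangent to a quartic surface at `n ≥ 3` distinct
points meets it with multiplicity `≥ 2n > 4`, so lies on it. `pg5_gauss_count`: the Gauss map of a genus-2 theta divisor has degree `2`,
so 'a constant direction is asymptotic at every point' confines `2x` to finitely many (`4`) theta translates — a curve, not the surface
(`1 < 2`). `pg5_involution_trace`: a Heisenberg involution of `ℙ³` has eigenvalues `(1,1,−1,−1)`: two fixed LINES; the planes `⟨x₁, L₂⟩`,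
`x₁ ∈ L₁`, are pairwise distinct and infinitely many, against `16` tropes. Shadows only.
-/

section ProductGroundFiveLines

/-- **No line on the Kummer quartic of a very general ppas (report §14.2 (a)).** `κ^*𝒪(1) = 𝒪(2Θ₀)`; a line `ℓ ⊂ Km` has
`κ⁻¹(ℓ) = Γ` with `2θ·Γ = deg(κ|_Γ)·deg ℓ ≤ 2·1`, while `Γ ≡ mθ` (`m ≥ 1`) gives `2θ·Γ = 4m ≥ 4`. [shadow] -/
theorem pg5_no_line_on_kummer (m d : ℕ) (hm : 1 ≤ m) (hd : d ≤ 2) : ¬ (4 * m = d * 1) := by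
  omega

/-- **Tangency count (report §14.2 (b)).** A line tangent to a quartic surface at `n` distinct points has intersection multiplicity
`≥ 2n` with it; for `n ≥ 3`, `2n > 4 = deg`, so the line lies on the surface. With `n = 2`: `2·2 = 4` — a genuine bitangent. [shadow] -/
theorem pg5_tangency_count (n : ℕ) : (3 ≤ n → 4 < 2 * n) ∧ 2 * 2 = 4 := by
  omega

/-- **The Gauss-map count (report §14.2 (c)).** The Gauss map of the symmetric genus-2 curve `Θ₀` is its canonical double cover of
`ℙ¹` (fibres `{y, −y}`, `2` points); the asymptotic directions of `Km` at `κ(x)` are the tangent directions at `x` of the two theta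
translates through `x` and `−x`; so 'the constant direction `ξ` is asymptotic at `κ(x)`' forces `2x ∈ ±y_ξ ± Θ₀` — at most `2·2 = 4`
theta translates, a locus of dimension `1 < 2`. [shadow: the counts] -/
theorem pg5_gauss_count : (2 : ℕ) * 2 = 4 ∧ (1 : ℕ) < 2 ∧ (2 : ℤ) * 2 - 2 = 2 * (2 * 0 - 2) + 6 := by
  refine ⟨by decide, by decide, by norm_num⟩

/-- **Heisenberg involutions (report §14.2 (d)).** Translation by a non-zero half-period acts on `H⁰(𝒪(2Θ₀)) ≅ ℂ⁴` with trace `0` and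
square a scalar: eigenvalues `(1,1,−1,−1)`, so the induced involution of `ℙ³` fixes two skew LINES (`2 + 2 = 4`); its invariant lines
are those meeting both. The planes spanned by a point of one fixed line and the other fixed line are pairwise distinct — infinitely
many — whereas the tropes number `16`. [shadow: `2 + 2 = 4`, `1·2 + (−1)·2 = 0`, `16 < 17`] -/
theorem pg5_involution_trace : (2 : ℤ) + 2 = 4 ∧ (1 : ℤ) * 2 + (-1) * 2 = 0 ∧ (16 : ℕ) < 17 := by
  decide

/-- **LEMMA W2, the descent count (report §14.1).** `φ_{2Θ₀}` has degree `2⁴ = 16`; `φ^*W₂ ≅ H ⊗ 𝒪(−2Θ₀)` with `dim H = h⁰(𝒪(2Θ₀)) = 4`;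
an equal-slope saturated subsheaf is `H' ⊗ 𝒪(−2Θ₀)` with `H'` a sub-representation of the Heisenberg group of type `(2,2)`, whose
Schrödinger representation of dimension `2·2 = 4` is irreducible: `dim H' ∈ {0, 4}` — no destabilising subsheaf of rank `1, 2, 3`.
[shadow] -/
theorem pg5_w2_descent (r : ℕ) (hr : r = 0 ∨ r = 4) : ¬ (1 ≤ r ∧ r ≤ 3) ∧ (2 : ℕ) ^ 4 = 16 ∧ 2 * 2 = 4 := by
  refine ⟨by omega, by decide, by decide⟩

end ProductGroundFiveLines

/-! ## ADDENDUM 5 (report [18] §15): THEOREM S12 and THEOREM ISO-MIN — the non-locally-free strata (S1)/(S2) carry no isolated point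
## either, so the double-sign jump locus `𝓙(R₂)` has NO isolated point at all and the minimal reading of R-PB3 is VOID

`pg5_s1_cohomology`: `h¹(𝓘_W) = (2 − 1) + 2 = 3`; for `W ⊂ C'` the cokernel `G` of `𝓘_W → 𝓘_W(C')` is `𝒪_{C'} ⊕ 𝒪_W` (the divisor `W`
on the genus-2 curve `C'` is canonical), `h⁰(G) = 1 + 2 = 3`, `χ(G) = (1 − 2) − (0 − 2) = 1`, the connecting map has rank `3 − 1 = 2`, so
the obstruction map `m` has a kernel of dimension `3 − 1 = 2 ≥ 2`: the admissible extension classes form a projective LINE minus at most a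
point — never a single point. `pg5_s2_moduli`: the (S2) data carry one continuous modulus (four non-zero components modulo a 3-dimensional
effective torus: `4 − 3 = 1`) and `P` moves in dimension `2`, the incidence `w ∈ C₊ ∩ C₋` fixing `w`: families of dimension `2 + 1 = 3`.
Shadows only.
-/

section ProductGroundFiveS12

/-- **(S1) cohomology (report §15.1).** `h¹(𝓘_W) = (h⁰(𝒪_W) − h⁰(𝒪)) + h¹(𝒪) = (2 − 1) + 2 = 3`; with `W ⊂ C'`: `h⁰(𝓘_W(C')) = 1`,
`G ≅ 𝒪_{C'} ⊕ 𝒪_W` has `h⁰ = 1 + 2 = 3` and `χ = 1`, the connecting map `H⁰(G) → H¹(𝓘_W)` has rank `3 − 1 = 2`, hence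
`dim ker(m) = 2` and `rank m = 3 − 2 = 1`; in the remaining cases `h¹(𝓘_ξ(C')) = −(1 − 2) = 1` bounds `rank m ≤ 1`. In all cases the
kernel has dimension `≥ 2`, so its projectivisation minus one point is a curve: no isolated admissible class. [shadow] -/
theorem pg5_s1_cohomology :
    (2 - 1) + 2 = (3 : ℤ) ∧ (1 : ℤ) + 2 = 3 ∧ ((1 : ℤ) - 2) - (0 - 2) = 1 ∧ (3 : ℤ) - 1 = 2 ∧ (3 : ℤ) - 2 = 1 ∧
    (-((1 : ℤ) - 2) = 1) ∧ (2 : ℤ) - 1 ≥ 1 := by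
  norm_num

/-- **(S2) moduli count (report §15.2).** Fully mixing data `(a_w, a_{−w}, b_w, b_{−w}) ∈ (ℂ^*)⁴` modulo `Aut P × Aut P⁻¹ × Aut S`
(`4` parameters acting through a `3`-dimensional quotient) leave `4 − 3 = 1` modulus `c`; with `P` free in `Pic⁰` (dimension `2`) and
`w` fixed by `w ∈ C₊ ∩ C₋` (`θ² = 2` points, an ι-orbit), the jump stratum has dimension `2 + 1 = 3 > 0`. [shadow] -/
theorem pg5_s2_moduli : (4 : ℕ) - 3 = 1 ∧ (2 : ℕ) + 1 = 3 ∧ (0 : ℕ) < 3 ∧ (1 : ℕ) * 2 = 2 := by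
  decide

/-- **THEOREM ISO-MIN bookkeeping (report §15.3).** The balanced moduli `𝓑(B₂)` is covered by LF (where `𝓙` has no isolated point by
ISO-LF + WIT) and the two non-locally-free shapes (S1), (S2) (no isolated point by S12): `1 + 2 = 3` strata, `0` isolated points, hence
(ISO-RED, `e₁ ≥ 1 + 1`) every member of the minimal reading's residual family has `e₁^ι ≥ 2`. [shadow] -/
theorem pg5_iso_min_count : (1 : ℕ) + 2 = 3 ∧ (0 : ℕ) = 0 ∧ (2 : ℕ) ≤ 1 + 1 := by
  decide

end ProductGroundFiveS12

end Summit.HodgeConjecture.HodgeConjecture.WeilTypeLadder
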